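import Summits.KontsevichZagierPeriods.KontsevichZagierPeriods.Theses.ComplexOrientations

/-!
# `KernelFormGlue` (stmt-KontsevichZagierPeriods-14292, route ComplexOrientations)

The plain kernel form of the Kontsevich–Zagier period conjecture for the calculus of moves —
every formal `ℤ`-combination of integral representations with value `0` lies in
`Literature.NumberTheory.Transcendental.KZ.relations` — implies the route's enlarged-kernel
target `OrientationKernel`: for every subgroup `R` of `KZ.FormalRep` with `KZ.relations ≤ R`
(whatever further relators it is asked to contain), a combination in `ker KZ.eval` lies in
`KZ.relations`, hence in `R`, by monotonicity alone. The three relator hypotheses of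
`OrientationKernel` (type-I unit-sign oval identities, integer oval-sector identities, Cauchy
relators) are not used.

`KernelFormGlue_proof` concludes the route declaration
`Summit.KontsevichZagierPeriods.KontsevichZagierPeriods.Theses.ComplexOrientations.KernelFormGlue`
by name. No definitions are introduced.

References: M. Kontsevich, D. Zagier, *Periods* (2001), §1.2; A. Huber, S. Müller-Stach,
*Periods and Nori Motives* (2017), §13.1 (kernel reformulation of the period conjecture).
-/

namespace Summit.KontsevichZagierPeriods.ComplexOrientations.KernelFormGlue

open Summit.KontsevichZagierPeriods.KontsevichZagierPeriods.Theses.ComplexOrientations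

/-- Settles stmt-KontsevichZagierPeriods-14292 (`KernelFormGlue`): if every formal
`ℤ`-combination of integral representations with value `0` lies in `KZ.relations`, then for
every additive subgroup `R ≥ KZ.relations` of `KZ.FormalRep` (in particular every `R` containing
the route's oval-sector and Cauchy relators) every such combination lies in `R`, i.e.
`OrientationKernel` holds. Proof: `x ∈ KZ.relations ≤ R`. [folklore] -/
theorem KernelFormGlue_proof :
    Summit.KontsevichZagierPeriods.KontsevichZagierPeriods.Theses.ComplexOrientations.KernelFormGlue := by
  unfold KernelFormGlue OrientationKernel
  intro hK R hR _ _ _ x hx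
  exact hR (hK x hx)

end Summit.KontsevichZagierPeriods.ComplexOrientations.KernelFormGlue
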